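import Literature.Analysis.FunctionSpaces.TorusTrigPoly
import Literature.Analysis.FunctionSpaces.TorusEnstrophyOrthogonality
import Literature.Analysis.FunctionSpaces.TorusMollifierEstimates
import Literature.Analysis.FunctionSpaces.TorusSobolevNorm
import Literature.Analysis.FunctionSpaces.TorusFourierCalculus
import Literature.Analysis.FunctionSpaces.TorusFourierConvolution
import Literature.Analysis.FunctionSpaces.TorusCalculusProofs
import Literature.Analysis.FunctionSpaces.TorusInverseLaplacianCalculus
import Literature.Analysis.FunctionSpaces.TorusFluidGlue
import HarnessLib

/-!
# Barrier family, part 3a (periodic witness, the field): the three-mode field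
# `v_c = c e₁ − c cos(2πx₁) e₀` on `𝕋³` is smooth and divergence-free but is not a Navier–Stokes /
# Euler velocity for any pressure (Fourier obstruction at the frequency `(0,1,0)`)

Family file of the barrier entry `DiffeomorphismNonInvariance` (catalogue `NavierStokesRegularity`,
D-0021; D-0090 NS-CLAIMS cell, salvage seat `ns-claims-salvage-p6`, METHOD LEVEL, everything PROVED),
namespace `…NavierStokesRegularity.DiffeoGauge`, flat torus `𝕋³ = UnitAddTorus (Fin 3)` (period `1`).
The periodic twin of part 1's bent stream, written as a real trigonometric polynomial
(`realTrigPoly`, three frequencies `0, ±(0,1,0)`): `kolmo c = c e₁ − c cos(2πx₁) e₀` (a Kolmogorov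
profile along `e₀` plus a uniform drift along the shear coordinate `x₁`). Proved here:
`isSmooth_kolmo`, `isDivFree_kolmo` (transversal coefficients), `convect_kolmo_apply_zero`
(`((v·∇)v)₀ = c ∂₁v₀`), `mFourierCoeff_kolmo_zero_f1` (`𝓕(v₀)(0,1,0) = −c/2`), and the OBSTRUCTION
`not_isClassicalNSSolutionOn_kolmo`: if `(v_c, q)` were a classical solution of the unforced system
(any real `ν`) on a time set `S ∋ t`, the `e₀`-component of the momentum equation reads
`∂₀q = νΔv₀ − c∂₁v₀` (`partialDeriv_pressure_kolmo`); its Fourier coefficient at `(0,1,0)` is `0` on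
the left (`k₀ = 0`) and `2π²νc + iπc²` on the right, so `c = 0`. Part 3b
(`DiffeomorphismNonInvarianceTorus`) identifies `v_c` as the conjugate of the uniform stream `c e₁` by
the transversal shear gauge of `𝕋³` and packages the periodic (Clay (B)-class, finite-energy) witness.

WHAT THIS IS NOT: not a claim about NS regularity or blow-up; not a claim about any author beyond the
typed locator.
-/

noncomputable section

open Set Function MeasureTheory UnitAddTorus
open scoped ContDiff RealInnerProductSpace

namespace Literature.Barriers.NavierStokesRegularity.DiffeoGauge

open Literature.Analysis.FunctionSpaces Literature.Analysis.FunctionSpaces.Torus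

/-! ### The conjugated field on `𝕋³` as a real trigonometric polynomial -/

/-- The frequency `(0, 1, 0) ∈ ℤ³` (one oscillation in the shear coordinate `x₁`). [folklore] -/
def f1 : Fin 3 → ℤ := Pi.single 1 1

/-- The frequency set `{0, (0,1,0), −(0,1,0)}`. [folklore] -/
def kolmoFreq : Finset (Fin 3 → ℤ) := {0, f1, -f1}

/-- The coefficients: `c e₁` at `k = 0`, `−(c/2) e₀` at `k = ±(0,1,0)`. [folklore] -/
def kolmoCoeff (c : ℝ) (k : Fin 3 → ℤ) : EuclideanSpace ℂ (Fin 3) :=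
  if k = 0 then EuclideanSpace.complexify (c • EuclideanSpace.single (1 : Fin 3) (1 : ℝ))
  else if k = f1 ∨ k = -f1 then
    EuclideanSpace.complexify ((-(c / 2)) • EuclideanSpace.single (0 : Fin 3) (1 : ℝ))
  else 0

/-- **The periodic bent stream** `v_c(x) = c e₁ − c cos(2πx₁) e₀` on `𝕋³ = (ℝ/ℤ)³`, as the real
trigonometric polynomial with the coefficients above (a Kolmogorov profile along `e₀` plus a uniform
drift along the shear coordinate). [folklore] -/
def kolmo (c : ℝ) : UnitAddTorus (Fin 3) → EuclideanSpace ℝ (Fin 3) :=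
  realTrigPoly kolmoFreq (kolmoCoeff c)

/-- `(0,1,0) ≠ 0`. [folklore] -/
private theorem f1_ne_zero : f1 ≠ 0 := by
  intro h; have := congrFun h 1; simp [f1] at this

/-- `(0,1,0) ≠ −(0,1,0)`. [folklore] -/
private theorem f1_ne_neg : f1 ≠ -f1 := by
  intro h; have := congrFun h 1; simp [f1] at this

/-- `−(0,1,0) ≠ 0`. [folklore] -/
private theorem neg_f1_ne_zero : -f1 ≠ 0 := by
  intro h; have := congrFun h 1; simp [f1] at this

/-- The frequency set is symmetric under `k ↦ −k`. [folklore] -/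
private theorem kolmoFreq_symm : ∀ k ∈ kolmoFreq, -k ∈ kolmoFreq := by
  intro k hk
  simp only [kolmoFreq, Finset.mem_insert, Finset.mem_singleton] at hk ⊢
  rcases hk with rfl | rfl | rfl <;> simp

/-- The coefficient at `k = 0`. [folklore] -/
private theorem kolmoCoeff_zero (c : ℝ) :
    kolmoCoeff c 0 = EuclideanSpace.complexify (c • EuclideanSpace.single (1 : Fin 3) (1 : ℝ)) := by
  simp [kolmoCoeff]

/-- The coefficient at `k = (0,1,0)`. [folklore] -/
private theorem kolmoCoeff_f1 (c : ℝ) :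
    kolmoCoeff c f1 = EuclideanSpace.complexify ((-(c / 2)) • EuclideanSpace.single (0 : Fin 3) (1 : ℝ)) := by
  simp [kolmoCoeff, f1_ne_zero]

/-- The coefficient at `k = −(0,1,0)`. [folklore] -/
private theorem kolmoCoeff_neg_f1 (c : ℝ) :
    kolmoCoeff c (-f1) =
      EuclideanSpace.complexify ((-(c / 2)) • EuclideanSpace.single (0 : Fin 3) (1 : ℝ)) := by
  simp only [kolmoCoeff, if_neg neg_f1_ne_zero, or_true, if_true]

/-- The coefficients are conjugate symmetric (the field is real). [folklore] -/
private theorem isConjSymm_kolmoCoeff (c : ℝ) : IsConjSymm (kolmoCoeff c) := by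
  intro k
  by_cases h0 : k = 0
  · subst h0; rw [neg_zero, kolmoCoeff_zero, EuclideanSpace.conjVec_complexify]
  by_cases h1 : k = f1
  · subst h1; rw [kolmoCoeff_neg_f1, kolmoCoeff_f1, EuclideanSpace.conjVec_complexify]
  by_cases h2 : k = -f1
  · subst h2; rw [neg_neg, kolmoCoeff_f1, kolmoCoeff_neg_f1, EuclideanSpace.conjVec_complexify]
  · have hn0 : -k ≠ 0 := fun h => h0 (neg_eq_zero.1 h)
    have hn1 : ¬ (-k = f1 ∨ -k = -f1) := by
      rintro (h | h)
      · exact h2 (by rw [← h, neg_neg])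
      · exact h1 (neg_injective h)
    have hk : ¬ (k = f1 ∨ k = -f1) := by rintro (h | h) <;> [exact h1 h; exact h2 h]
    unfold kolmoCoeff
    rw [if_neg hn0, if_neg hn1, if_neg h0, if_neg hk, EuclideanSpace.conjVec_zero]

/-- Sums over the three frequencies `{0, ±(0,1,0)}` split into three terms (Fourier-side bookkeeping of
the three-mode field). [cite: Grafakos2014, §3.1.1] -/
theorem sum_kolmoFreq {M : Type*} [AddCommMonoid M] (g : (Fin 3 → ℤ) → M) :
    ∑ k ∈ kolmoFreq, g k = g 0 + (g f1 + g (-f1)) := by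
  have h1 : (0 : Fin 3 → ℤ) ∉ ({f1, -f1} : Finset (Fin 3 → ℤ)) := by
    simp only [Finset.mem_insert, Finset.mem_singleton, not_or]
    exact ⟨f1_ne_zero.symm, neg_f1_ne_zero.symm⟩
  have h2 : f1 ∉ ({-f1} : Finset (Fin 3 → ℤ)) := by
    simp only [Finset.mem_singleton]; exact f1_ne_neg
  rw [kolmoFreq, Finset.sum_insert h1, Finset.sum_insert h2, Finset.sum_singleton]

/-- Coordinates of the three Fourier coefficients of `v_c` (`c e₁` at `0`, `−(c/2) e₀` at `±(0,1,0)`).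
[cite: Grafakos2014, §3.1.1] -/
theorem kolmoCoeff_apply (c : ℝ) :
    (kolmoCoeff c 0 0 = 0 ∧ kolmoCoeff c 0 1 = c ∧ kolmoCoeff c 0 2 = 0) ∧
    (kolmoCoeff c f1 0 = ((-(c / 2) : ℝ) : ℂ) ∧ kolmoCoeff c f1 1 = 0 ∧ kolmoCoeff c f1 2 = 0) ∧
    (kolmoCoeff c (-f1) 0 = ((-(c / 2) : ℝ) : ℂ) ∧ kolmoCoeff c (-f1) 1 = 0 ∧ kolmoCoeff c (-f1) 2 = 0) := by
  refine ⟨?_, ?_, ?_⟩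
  · rw [kolmoCoeff_zero]; simp [EuclideanSpace.complexify_apply]
  · rw [kolmoCoeff_f1]; simp [EuclideanSpace.complexify_apply]
  · rw [kolmoCoeff_neg_f1]; simp [EuclideanSpace.complexify_apply]

/-- The drift coordinate: `(v_c)₁ ≡ c`. [folklore] -/
private theorem kolmo_apply_one (c : ℝ) (x : UnitAddTorus (Fin 3)) : kolmo c x 1 = c := by
  rw [kolmo, realTrigPoly_apply_coord, trigPoly_apply_coord, sum_kolmoFreq]
  obtain ⟨⟨-, h01, -⟩, ⟨-, h11, -⟩, ⟨-, h21, -⟩⟩ := kolmoCoeff_apply c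
  rw [h01, h11, h21, mFourier_zero]
  simp

/-- `(v_c)₂ ≡ 0`. [folklore] -/
private theorem kolmo_apply_two (c : ℝ) (x : UnitAddTorus (Fin 3)) : kolmo c x 2 = 0 := by
  rw [kolmo, realTrigPoly_apply_coord, trigPoly_apply_coord, sum_kolmoFreq]
  obtain ⟨⟨-, -, h02⟩, ⟨-, -, h12⟩, ⟨-, -, h22⟩⟩ := kolmoCoeff_apply c
  rw [h02, h12, h22]
  simp

/-- `v_c` is divergence-free (its coefficients are transversal: `k · c(k) = 0`).
[cite: RobinsonRodrigoSadowski2016, Def. 2.1] -/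
theorem isDivFree_kolmo (c : ℝ) : IsDivFree (kolmo c) := by
  refine isDivFree_realTrigPoly ?_
  intro k hk
  simp only [kolmoFreq, Finset.mem_insert, Finset.mem_singleton] at hk
  obtain ⟨⟨h00, h01, h02⟩, ⟨h10, h11, h12⟩, ⟨h20, h21, h22⟩⟩ := kolmoCoeff_apply c
  rcases hk with rfl | rfl | rfl
  · simp
  · rw [Fin.sum_univ_three, h10, h11, h12]; simp [f1]
  · rw [Fin.sum_univ_three, h20, h21, h22]; simp [f1]

/-- `∂₀ v_c = 0` and `∂₂ v_c = 0` (no dependence on `x₀`, `x₂`: every frequency in the support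
has vanishing `0`-th and `2`-nd components). [folklore] -/
private theorem partialDeriv_kolmo_eq_zero (c : ℝ) (x : UnitAddTorus (Fin 3)) :
    partialDeriv 0 (kolmo c) x = 0 ∧ partialDeriv 2 (kolmo c) x = 0 := by
  have key : ∀ j : Fin 3, (∀ k ∈ kolmoFreq, (k j : ℂ) = 0) → partialDeriv j (kolmo c) x = 0 := by
    intro j hj
    rw [kolmo, partialDeriv_realTrigPoly]
    have h0 : realTrigPoly kolmoFreq (fun k => (2 * Real.pi * Complex.I * (k j)) • kolmoCoeff c k) =
        realTrigPoly kolmoFreq (0 : (Fin 3 → ℤ) → EuclideanSpace ℂ (Fin 3)) :=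
      realTrigPoly_congr fun k hk => by simp [hj k hk]
    rw [h0, realTrigPoly_zero]
    rfl
  have hmem : ∀ k ∈ kolmoFreq, (k 0 : ℂ) = 0 ∧ (k 2 : ℂ) = 0 := by
    intro k hk
    simp only [kolmoFreq, Finset.mem_insert, Finset.mem_singleton] at hk
    rcases hk with rfl | rfl | rfl <;> simp [f1]
  exact ⟨key 0 fun k hk => (hmem k hk).1, key 2 fun k hk => (hmem k hk).2⟩

/-- **The inertial term of `v_c`**: `((v_c·∇)v_c)₀ = c ∂₁(v_c)₀` (only the drift `c e₁` differentiates
the profile; Acheson's reduction (2.9) of the inertial term for a parallel profile, here with a drift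
along the shear coordinate). [cite: Acheson1990, §2.3 eq. (2.9)] -/
theorem convect_kolmo_apply_zero (c : ℝ) (x : UnitAddTorus (Fin 3)) :
    convect (kolmo c) (kolmo c) x 0 = c * partialDeriv 1 (fun y => kolmo c y 0) x := by
  have h1 : IsContDiff 1 (kolmo c) := (isSmooth_realTrigPoly _ _).isContDiff (by simp)
  rw [convect_eq_sum_smul_partialDeriv h1, Fin.sum_univ_three, (partialDeriv_kolmo_eq_zero c x).1,
    (partialDeriv_kolmo_eq_zero c x).2, kolmo_apply_one]
  simp [partialDeriv_apply_coord h1]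

/-- `v_c` is smooth (a real trigonometric polynomial). [cite: RobinsonRodrigoSadowski2016, §4.1] -/
theorem isSmooth_kolmo (c : ℝ) : IsSmooth (kolmo c) := isSmooth_realTrigPoly _ _

/-! ### Fourier bookkeeping for real smooth functions (complexified coefficients) -/

/-- Continuous real functions on the torus complexify to integrable ones. [folklore] -/
private theorem integrable_ofReal {f : UnitAddTorus (Fin 3) → ℝ} (hf : Continuous f) :
    Integrable (fun x => (f x : ℂ)) volume :=
  (Complex.continuous_ofReal.comp hf : Continuous fun x => (f x : ℂ)).integrable_unitAddTorus

/-- `𝓕(f − g) = 𝓕f − 𝓕g` (complexified). [folklore] -/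
private theorem fc_sub {f g : UnitAddTorus (Fin 3) → ℝ} (hf : Continuous f) (hg : Continuous g)
    (k : Fin 3 → ℤ) :
    mFourierCoeff (fun x => (((f x - g x : ℝ)) : ℂ)) k =
      mFourierCoeff (fun x => (f x : ℂ)) k - mFourierCoeff (fun x => (g x : ℂ)) k := by
  simp only [mFourierCoeff_eq_integral_volume, Complex.ofReal_sub, smul_sub]
  exact integral_sub (integrable_mFourier_smul' (integrable_ofReal hf) k)
    (integrable_mFourier_smul' (integrable_ofReal hg) k)

/-- `𝓕(a f) = a 𝓕f` for a real constant `a` (complexified). [folklore] -/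
private theorem fc_const_mul (a : ℝ) (f : UnitAddTorus (Fin 3) → ℝ) (k : Fin 3 → ℤ) :
    mFourierCoeff (fun x => (((a * f x : ℝ)) : ℂ)) k = (a : ℂ) * mFourierCoeff (fun x => (f x : ℂ)) k := by
  have h : (fun x => (((a * f x : ℝ)) : ℂ)) = ((a : ℂ)) • fun x => (f x : ℂ) := by
    funext x; simp
  rw [h, mFourierCoeff_const_smul, smul_eq_mul]

/-- `𝓕(∂ⱼf)(k) = 2πi kⱼ 𝓕f(k)` for smooth real `f` (complexified). [cite: Grafakos2014, Prop. 3.1.2 (10)] -/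
private theorem fc_partialDeriv {f : UnitAddTorus (Fin 3) → ℝ} (hf : IsSmooth f) (j : Fin 3)
    (k : Fin 3 → ℤ) :
    mFourierCoeff (fun x => (((partialDeriv j f x : ℝ)) : ℂ)) k =
      (2 * Real.pi * Complex.I * (k j)) * mFourierCoeff (fun x => (f x : ℂ)) k := by
  have hc : (fun x => (((partialDeriv j f x : ℝ)) : ℂ)) =
      partialDeriv j (fun x => (((f x : ℝ)) : ℂ)) := by
    funext x; exact (partialDeriv_clm_comp hf Complex.ofRealCLM j x).symm
  rw [hc, mFourierCoeff_partialDeriv hf.ofReal, smul_eq_mul]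

/-- `𝓕(Δf)(k) = −4π²|k|² 𝓕f(k)` for smooth real `f` (complexified). [cite: Grafakos2014, Prop. 3.1.2 (10)] -/
private theorem fc_laplacian {f : UnitAddTorus (Fin 3) → ℝ} (hf : IsSmooth f) (k : Fin 3 → ℤ) :
    mFourierCoeff (fun x => (((laplacian f x : ℝ)) : ℂ)) k =
      -((4 * Real.pi ^ 2 * freqNormSq k : ℝ) : ℂ) * mFourierCoeff (fun x => (f x : ℂ)) k := by
  have hc : (fun x => (((laplacian f x : ℝ)) : ℂ)) = laplacian (fun x => (((f x : ℝ)) : ℂ)) := by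
    funext x; exact (laplacian_clm_comp_apply hf Complex.ofRealCLM x).symm
  rw [hc, mFourierCoeff_laplacian_complex hf.ofReal]

/-- **The `e₀`-coordinate of `v_c` has Fourier coefficient `−c/2` at the frequency `(0,1,0)`.**
[cite: Grafakos2014, §3.1.1] -/
theorem mFourierCoeff_kolmo_zero_f1 (c : ℝ) :
    mFourierCoeff (fun x => ((kolmo c x 0 : ℝ) : ℂ)) f1 = ((-(c / 2) : ℝ) : ℂ) := by
  rw [← mFourierCoeff_complexify_apply (isSmooth_kolmo c).integrable f1 0]
  have h : mFourierCoeff (EuclideanSpace.complexify ∘ kolmo c) f1 = kolmoCoeff c f1 := by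
    rw [kolmo, mFourierCoeff_realTrigPoly kolmoFreq_symm (isConjSymm_kolmoCoeff c), if_pos]
    simp [kolmoFreq]
  rw [h]
  exact (kolmoCoeff_apply c).2.1.1

/-- `|(0,1,0)|² = 1`. [folklore] -/
private theorem freqNormSq_f1 : freqNormSq f1 = 1 := by
  simp [freqNormSq, f1, Fin.sum_univ_three]

/-! ### The periodic bent stream is not a Navier–Stokes (or Euler) velocity for any pressure -/

/-- **Momentum forces `∂₀q = ν Δ(v_c)₀ − c ∂₁(v_c)₀`**: if `(v_c, q)` is a classical solution of the
unforced system (any real `ν`) on a time set `S ∋ t`, then at time `t`, pointwise on `𝕋³`,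
`∂₀ q = ν Δ g − c ∂₁ g` with `g = (v_c)₀`. [cite: Acheson1990, §2.3 eq. (2.9)] -/
theorem partialDeriv_pressure_kolmo {S : Set ℝ} {ν c : ℝ} {q : ℝ → UnitAddTorus (Fin 3) → ℝ}
    (h : Torus.IsClassicalNSSolutionOn S ν 0 (fun _ => kolmo c) q) {t : ℝ} (ht : t ∈ S)
    (x : UnitAddTorus (Fin 3)) :
    partialDeriv 0 (q t) x =
      ν * laplacian (fun y => kolmo c y 0) x - c * partialDeriv 1 (fun y => kolmo c y 0) x := by
  have hm := h.momentum t ht x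
  have h0 : Torus.timeDerivWithin S (fun _ : ℝ => kolmo c) t x = 0 := by
    simp [Torus.timeDerivWithin]
  rw [h0, zero_add] at hm
  have hq1 : IsContDiff 1 (q t) := (h.smooth_pressure.isSmooth_slice ht).isContDiff (by simp)
  have hgrad : Torus.gradient (q t) x = ν • laplacian (kolmo c) x - convect (kolmo c) (kolmo c) x := by
    rw [hm]; simp
  have hcoord := congrArg (fun v : EuclideanSpace ℝ (Fin 3) => v 0) hgrad
  simp only [PiLp.sub_apply, PiLp.smul_apply, smul_eq_mul] at hcoord
  rw [gradient_apply hq1, convect_kolmo_apply_zero] at hcoord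
  have hlap : laplacian (kolmo c) x 0 = laplacian (fun y => kolmo c y 0) x :=
    (laplacian_clm_comp_apply (isSmooth_kolmo c) (EuclideanSpace.proj (0 : Fin 3)) x).symm
  rw [hlap] at hcoord
  exact hcoord

/-- **The periodic bent stream is not a classical Navier–Stokes / Euler velocity on `𝕋³`**: for
`c ≠ 0`, every real `ν`, every nonempty time set `S` and every pressure `q`, `(v_c, q)` is not a
classical solution — comparing the Fourier coefficients of `∂₀q = νΔg − c∂₁g` at the frequency
`(0,1,0)`: the left side vanishes (`k₀ = 0`), the right side is `2π²νc + iπc²`.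
[cite: Acheson1990, §2.3 eq. (2.9)] -/
theorem not_isClassicalNSSolutionOn_kolmo {S : Set ℝ} {t : ℝ} (ht : t ∈ S) {c : ℝ} (hc : c ≠ 0)
    (ν : ℝ) (q : ℝ → UnitAddTorus (Fin 3) → ℝ) :
    ¬ Torus.IsClassicalNSSolutionOn S ν 0 (fun _ => kolmo c) q := by
  intro h
  have hq : IsSmooth (q t) := h.smooth_pressure.isSmooth_slice ht
  have hg : IsSmooth (fun y => kolmo c y 0) := (isSmooth_kolmo c).apply 0
  have hfun : (fun x => ((partialDeriv 0 (q t) x : ℝ) : ℂ)) = fun x =>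
      (((ν * laplacian (fun y => kolmo c y 0) x - c * partialDeriv 1 (fun y => kolmo c y 0) x : ℝ)) : ℂ) :=
    funext fun x => by rw [partialDeriv_pressure_kolmo h ht x]
  have hF := congrArg (fun F : UnitAddTorus (Fin 3) → ℂ => mFourierCoeff F f1) hfun
  simp only at hF
  rw [fc_partialDeriv hq 0 f1,
    fc_sub ((hg.laplacian.continuous).const_smul ν |>.congr fun x => by simp [smul_eq_mul])
      ((hg.partialDeriv 1).continuous.const_smul c |>.congr fun x => by simp [smul_eq_mul]),
    fc_const_mul ν, fc_const_mul c, fc_laplacian hg, fc_partialDeriv hg 1, mFourierCoeff_kolmo_zero_f1,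
    freqNormSq_f1] at hF
  have hf10 : ((f1 0 : ℤ) : ℂ) = 0 := by simp [f1]
  have hf11 : ((f1 1 : ℤ) : ℂ) = 1 := by simp [f1]
  rw [hf10, hf11] at hF
  -- hF : 2π i·0·𝓕q = ν(−4π²)(−c/2) − c(2πi)(−c/2); take imaginary parts
  have him := congrArg Complex.im hF
  have hpim : ((Real.pi : ℂ) ^ 2).im = 0 := by rw [← Complex.ofReal_pow, Complex.ofReal_im]
  simp [hpim] at him
  -- him : 0 = c * (2 * π * (c / 2)), i.e. π c² = 0
  have hc2 : 0 < c ^ 2 := lt_of_le_of_ne (sq_nonneg c) (Ne.symm (pow_ne_zero 2 hc))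
  nlinarith [Real.pi_pos, hc2, him, mul_pos Real.pi_pos hc2]

end Literature.Barriers.NavierStokesRegularity.DiffeoGauge

end
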